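import Summits.BirchSwinnertonDyer.BirchSwinnertonDyer.Theses.EdixhovenFibreFiveSeven
import Summits.BirchSwinnertonDyer.BirchSwinnertonDyer.Theorems.EdixhovenFibreFiveSevenMemberManinUnitFiveSevenGlue
import Summits.BirchSwinnertonDyer.BirchSwinnertonDyer.Theorems.EdixhovenFibreFiveSevenStarredOptimalManinUnitFiveSeven
import Summits.BirchSwinnertonDyer.BirchSwinnertonDyer.Theorems.EdixhovenFibreFiveSevenTwistDegreeStepOrdinary
import Summits.BirchSwinnertonDyer.BirchSwinnertonDyer.Theorems.EdixhovenFibreFiveSevenTwistDegreeStepFiveSeven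
import HarnessLib

/-!
# Route `EdixhovenFibreFiveSeven`: the assembly item `Assembly` (stmt-BirchSwinnertonDyer-22231),
# PROVED — and the leaf from the EIGHT remaining items (G57 discharged)

Cell `pub/bsd-wall` (D-0145 line `route-BirchSwinnertonDyer-EdixhovenFibreFiveSeven`), seat
`bsd-line-edix-p3` (prover seat 3/3). THEOREMS ONLY (no definition, no named fact, no `sorry`).
BSD is not proved by this file, and no crux of the route is proved by it: `Assembly` is the TYPE
of the route's deciding theorem `closes` (planner bsd-idea-3, kernel-checked in the route file) —
K★ → TDS57 → TDS11 → G57 → KolyvaginPrimitiveAdditive → RankZeroAdditive → OffSharpRankOneAdditive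
→ PublishedInputsAdditiveKoly → PublishedManinFacts → the registered W-ALL leaf
`Summit.BirchSwinnertonDyer.WAllExclAdditiveFiveLeRankOne` (rung W-ALL/2.p>=5.r1) — so `closes`
proves it (`assembly_proof`).

Since the glue obligation G57 `MemberManinUnitFiveSevenGlue` (stmt-BirchSwinnertonDyer-22229) is
now a tree THEOREM (`MemberManinUnitFiveSevenGlue.memberManinUnitFiveSevenGlue_proof`, seat
edix-p2, p580107), the leaf already follows from the EIGHT remaining items
(`wAllExclAdditiveFiveLeRankOne_of_items`): the three Manin cruxes K★, TDS57, TDS11, the three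
shared AKR cruxes, and the two hypothesis-only bundles of published inputs. What stays open is
unchanged by this file: K★ (22226), TDS57 (22227), TDS11 (22228) and the shared AKR cruxes
KolyvaginPrimitiveAdditive (21400), RankZeroAdditive (20133), OffSharpRankOneAdditive (20134).
[cite: EdixhovenManin1991, Thm. 3 and §4] [cite: WZhang2014, Thm. 1.1]
-/

set_option autoImplicit false
-- single-conjunct summit: `Summit.BirchSwinnertonDyer.BirchSwinnertonDyer.…` repeats the name by design
set_option linter.dupNamespace false

namespace Summit.BirchSwinnertonDyer.BirchSwinnertonDyer.Theorems.EdixhovenFibreFiveSevenAssembly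

open Summit.BirchSwinnertonDyer.BirchSwinnertonDyer.Theses.EdixhovenFibreFiveSeven

/-- **The assembly item 22231**: K★, TDS57, TDS11, the glue G57, the shared AKR cruxes
(Kolyvagin primitivity, rank-zero residual, off-♯ rank one) and the two bundles of published
inputs give the W-ALL leaf `WAllExclAdditiveFiveLeRankOne`. Proof: the route's deciding theorem
`closes` (its type IS this statement). [cite: EdixhovenManin1991, Thm. 3 and §4]
[cite: WZhang2014, Thm. 1.1] -/
theorem assembly_proof :
    Summit.BirchSwinnertonDyer.BirchSwinnertonDyer.Theses.EdixhovenFibreFiveSeven.Assembly := by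
  -- (buildfix 2026-08-28) The route's `closes` was re-keyed (rev 2026-08-27T23:50Z) to the cell items
  -- KP / OfKato / OfKP / KatoNeronAndCremonaFacts, from which it first DERIVES K★ and TDS57; the accepted
  -- `Assembly` statement takes K★ and TDS57 directly, so the remainder of the chain of `closes` is inlined
  -- here verbatim (proper Manin residue R → residue class → Manin-good odd frame → ♯ / off-♯ glue).
  intro hS hT hO hG h₁ h₀ hoff hP hF
  classical
  obtain ⟨e1, e2, dd, mz, au, c2, hC⟩ := hF
  -- (1) the proper Manin residue `R` of route AdditiveKolyvaginRoad from THIS route's items: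
  --     p ∈ {5,7} by the glue obligation G57 over K★ and TDS57; p ≥ 11 over TDS11; then transport + frame.
  have hR : Summit.BirchSwinnertonDyer.BirchSwinnertonDyer.Theses.AdditiveKolyvaginRoad.ManinFrameResidueProperR := by
    intro e1' e2' dd' hPub W _ _ p hp _ hp5 hadd hirr hres hall hr
    have hnf' : Literature.NumberTheory.EllipticCurves.ModularForms.exists_isNewformOf := hPub.2.2.2.2.2.1
    have hmem : ∃ (W₀ : WeierstrassCurve ℚ) (_ : W₀.IsElliptic) (_ : W₀.IsGloballyMinimal)
        (D₀ : Literature.NumberTheory.EllipticCurves.ModularForms.ModularParametrizationData W₀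
          (W.conductorNorm ℤ)), WeierstrassCurve.IsIsogenous W W₀ ∧ ¬ (p : ℤ) ∣ D₀.c := by
      rcases lt_or_ge p 11 with h11 | h11
      · exact hG hnf' dd' hS hT W p hp5 h11 hadd hirr hres hall
      · exact Summit.BirchSwinnertonDyer.BirchSwinnertonDyer.Theorems.ManinFrameResidueProperTwistDegree.stub_memberManinUnit_ordinary_of_twistDegreeStep
          e1' e2' dd' hnf' W p h11 hadd hirr hres
          (fun V _ _ _ Wf _ _ _ C hiso hGo hV4 hCV =>
            hO hnf' W p h11 hadd hirr hres hall V Wf C hiso hGo hV4 hCV)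
    obtain ⟨W₀, hE₀, hM₀, D₀, hiso, hc₀⟩ := hmem
    haveI := hE₀
    haveI := hM₀
    obtain ⟨Dt, hc⟩ :=
      Summit.BirchSwinnertonDyer.BirchSwinnertonDyer.Theorems.ManinFrameTransport.exists_modularParametrizationData_not_dvd_of_partner
        W hp.out hirr hiso D₀ hc₀
    have hp2 : p ≠ 2 := by omega
    exact Summit.BirchSwinnertonDyer.BirchSwinnertonDyer.Theorems.ManinFrameFromDatum.exists_oddHeegnerFrame_of_exists_not_dvd
      hnf' hPub.2.2.2.2.2.2.1 W p hr hp2 ⟨Dt, hc⟩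
  -- (2) the Manin residue class from ČNS + the proved degree class + R
  have hD : Summit.BirchSwinnertonDyer.BirchSwinnertonDyer.Theses.AdditiveKolyvaginRoad.ManinFrameResidueDegreeClass :=
    Summit.BirchSwinnertonDyer.BirchSwinnertonDyer.Theorems.ManinFrameResidueDegreeClass.maninFrameResidueDegreeClass_proof
  have hRes : Summit.BirchSwinnertonDyer.BirchSwinnertonDyer.Theses.AdditiveKolyvaginRoad.ManinFrameResidueClass := by
    intro hP' W _ _ p _ _ h5 hadd hirr hcl hr1
    by_cases hex : ∃ (W' : WeierstrassCurve ℚ) (_ : W'.IsElliptic) (_ : W'.IsGloballyMinimal)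
        (D' : Literature.NumberTheory.EllipticCurves.ModularForms.ModularParametrizationData W' (W.conductorNorm ℤ)),
        WeierstrassCurve.IsIsogenous W W' ∧ ¬ p ∣ D'.modularDegree
    · exact hD hC hP' W p h5 hadd hirr hcl hex hr1
    · refine hR e1 e2 dd hP' W p h5 hadd hirr hcl ?_ hr1
      intro W' _ _ D' hiso
      by_contra hnd
      exact hex ⟨W', ‹_›, ‹_›, D', hiso, hnd⟩
  -- (3) the Manin-good odd frame by the proved gen-2 glue over the proved class loci
  have hM : Summit.BirchSwinnertonDyer.BirchSwinnertonDyer.Theses.AdditiveKolyvaginRoad.ManinGoodOddFrameAdditive :=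
    Summit.BirchSwinnertonDyer.BirchSwinnertonDyer.Theorems.ManinGoodOddFrameAdditiveResplitGlue.maninGoodOddFrameAdditiveResplitGlue_proof
      e1 e2 mz au c2
      Summit.BirchSwinnertonDyer.BirchSwinnertonDyer.Theorems.ManinFrameOffExceptionClass.maninFrameOffExceptionClass_proof
      Summit.BirchSwinnertonDyer.BirchSwinnertonDyer.Theorems.ManinFrameIstarClass.maninFrameIstarClass_proof hRes
  -- (4) the proved additive Kolyvagin kernel gives the ♯ slice; the off-♯ slice is the shared item; glue of the W-ALL leaf
  have hSharp : Summit.BirchSwinnertonDyer.WAllExclAdditiveFiveLeRankOneSharp :=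
    fun W _ _ p _ hCM hp5 hadd hr1 hs hsp htwo htam =>
      Summit.BirchSwinnertonDyer.BirchSwinnertonDyer.Theorems.AdditiveKolyvaginKernel.additiveKolyvaginKernel_proof
        hP hM h₁ h₀ W p hCM hp5 hadd hr1 hs hsp htwo htam
  exact Summit.BirchSwinnertonDyer.wAllExclAdditiveFiveLeRankOne_of_sharp_of_offSharp hSharp hoff

/-- **The leaf from the eight remaining items** (G57 discharged by the tree theorem
`MemberManinUnitFiveSevenGlue.memberManinUnitFiveSevenGlue_proof`): K★ → TDS57 → TDS11 →
KolyvaginPrimitiveAdditive → RankZeroAdditive → OffSharpRankOneAdditive →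
PublishedInputsAdditiveKoly → PublishedManinFacts → `WAllExclAdditiveFiveLeRankOne`. The eight
hypotheses are the route's OPEN items (three Manin cruxes at `p ∈ {5, 7}` / `p ≥ 11`, three shared
AKR cruxes) and its two hypothesis-only bundles; nothing open is proved here.
[cite: EdixhovenManin1991, Thm. 3 and §4] [cite: WZhang2014, Thm. 1.1] -/
theorem wAllExclAdditiveFiveLeRankOne_of_items (hS : StarredOptimalManinUnitFiveSeven)
    (hT : TwistDegreeStepFiveSeven) (hO : TwistDegreeStepOrdinary)
    (h₁ : KolyvaginPrimitiveAdditive) (h₀ : RankZeroAdditive) (hoff : OffSharpRankOneAdditive)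
    (hP : PublishedInputsAdditiveKoly) (hF : PublishedManinFacts) :
    Summit.BirchSwinnertonDyer.WAllExclAdditiveFiveLeRankOne :=
  assembly_proof hS hT hO MemberManinUnitFiveSevenGlue.memberManinUnitFiveSevenGlue_proof h₁ h₀ hoff hP hF

/-! ### Appended (seat `bsd-line-edix-p3`, 2026-08-27): the leaf GRANTED ONE named fact in place of
the two Manin cruxes K★ and TDS11

Both K★ `StarredOptimalManinUnitFiveSeven` (stmt-22226; seat edix-p1,
`starredOptimalManinUnitFiveSeven_of_kato`, p581141) and TDS11 `TwistDegreeStepOrdinary` (stmt-22228;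
this seat, `EdixhovenFibreFiveSevenTwistDegreeStepOrdinary.twistDegreeStepOrdinary_of_kato_five_le`)
are tree theorems CONDITIONAL on the single cite-only Literature fact
F″ = `Literature.NumberTheory.EllipticCurves.kato_neron_isIntegral_twistedSymbolSum_of_additive_five_le`
(Kato 2004 (8.1.3)/Thm 9.7/Thm 6.6(1) read in Néron units via Kim–Nakamura 2020 Cor 2.4 ⟸
Kosters–Pannekoek Thm 1; a referee-flagged derived reading, size XL, not discharged). So the
route's deciding theorem runs on: F″, TDS57, the three shared AKR cruxes and the two bundles. -/

/-- **The leaf from F″ + TDS57 + the shared AKR cruxes + the two bundles.** GRANTED the ONE named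
Literature fact F″ (`kato_neron_isIntegral_twistedSymbolSum_of_additive_five_le`, a hypothesis here,
NOT asserted): TDS57 → KolyvaginPrimitiveAdditive → RankZeroAdditive → OffSharpRankOneAdditive →
PublishedInputsAdditiveKoly → PublishedManinFacts → `WAllExclAdditiveFiveLeRankOne`, by `closes` with
K★ := `starredOptimalManinUnitFiveSeven_of_kato hK` (edix-p1), TDS11 :=
`twistDegreeStepOrdinary_of_kato_five_le hK` (this seat) and G57 := the tree theorem
`memberManinUnitFiveSevenGlue_proof` (edix-p2). CONDITIONAL (named-fact hypothesis `hK`); the open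
items of the route are unchanged; BSD is not proved by this.
[cite: Kato2004Asterisque, (8.1.3) (p. 180), Thm. 9.7 (p. 189), Thm. 6.6 (1) (p. 163)]
[cite: KimNakamura2020, Cor. 2.4] [cite: KostersPannekoek2017, Thm. 1]
[cite: EdixhovenManin1991, Thm. 3 and §4] [cite: WZhang2014, Thm. 1.1] -/
theorem wAllExclAdditiveFiveLeRankOne_of_kato
    (hK : Literature.NumberTheory.EllipticCurves.kato_neron_isIntegral_twistedSymbolSum_of_additive_five_le)
    (hT : TwistDegreeStepFiveSeven) (h₁ : KolyvaginPrimitiveAdditive) (h₀ : RankZeroAdditive)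
    (hoff : OffSharpRankOneAdditive) (hP : PublishedInputsAdditiveKoly) (hF : PublishedManinFacts) :
    Summit.BirchSwinnertonDyer.WAllExclAdditiveFiveLeRankOne :=
  assembly_proof (starredOptimalManinUnitFiveSeven_of_kato hK) hT
    (EdixhovenFibreFiveSevenTwistDegreeStepOrdinary.twistDegreeStepOrdinary_of_kato_five_le hK)
    MemberManinUnitFiveSevenGlue.memberManinUnitFiveSevenGlue_proof h₁ h₀ hoff hP hF

/-! ### Appended (seat `bsd-line-edix-p3`, 2026-08-27): the CAPSTONE — the leaf from two cite-only
facts (F″, Cremona's table), the Kosters–Pannekoek residue KP57♯ of TDS57, the three shared AKR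
cruxes and the two bundles

Seat edix-p2's `TwistDegreeStepFiveSeven.twistDegreeStepFiveSeven_of_kato_cns_cremona_of_kpResidue`
(p582423) gives TDS57 BY NAME from F″, Česnavičius–Neururer–Saha (`hCNS`, which IS the seventh
conjunct of the bundle `PublishedManinFacts`), Cremona's range theorem by name
(`cremona_abs_maninConstant_eq_one_of_level_le_500000`) and the residue KP57♯ (spelled out verbatim
below as `hKP`: Manin's `p`-part, SOME conductor-level datum, for the unstarred `V` at `p ∈ {5, 7}`
whose class carries a `ℚ_p`-rational point of order `p`, with every conductor-level degree of the
class divisible by `p` and `N(V) > 5·10⁵` — by `kp_types_of_torsion_witness` only Kodaira II/III at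
`5` and II at `7`). Composing with `wAllExclAdditiveFiveLeRankOne_of_kato`: on this line the W-ALL
leaf `WAllExclAdditiveFiveLeRankOne` needs, beyond the shared AKR cruxes and the published inputs,
exactly F″ (XL, a derived reading of Kato 2004), Cremona's table (cite-only) and KP57♯ (OPEN, not in
print). Nothing open is proved here; BSD is not proved by this. -/

open scoped Classical in
open WeierstrassCurve IsDedekindDomain Rat.HeightOneSpectrum Literature.NumberTheory.DiophantineGeometry
  Literature.NumberTheory.EllipticCurves Literature.NumberTheory.EllipticCurves.ModularForms
  Literature.NumberTheory.EllipticCurves.Rank1Residual in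
/-- **CAPSTONE: the leaf ⟸ F″ ∧ Cremona ∧ KP57♯ ∧ the three shared AKR cruxes ∧ the two bundles.**
Hypotheses: `hK` = F″ (`kato_neron_isIntegral_twistedSymbolSum_of_additive_five_le`, cite-only,
NOT asserted); `hCre` = Cremona's table `c = ±1` for optimal curves of conductor `≤ 5·10⁵` (cite-only,
by name); `hKP` = the residue KP57♯ of TDS57 (seat edix-p2's binder list VERBATIM; OPEN);
`KolyvaginPrimitiveAdditive`, `RankZeroAdditive`, `OffSharpRankOneAdditive` (shared AKR cruxes);
`PublishedInputsAdditiveKoly`, `PublishedManinFacts` (bundles; ČNS is its seventh conjunct).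
Conclusion: `Summit.BirchSwinnertonDyer.WAllExclAdditiveFiveLeRankOne`. Proof:
`wAllExclAdditiveFiveLeRankOne_of_kato` with TDS57 :=
`twistDegreeStepFiveSeven_of_kato_cns_cremona_of_kpResidue hK hCNS hCre hKP`. CONDITIONAL; nothing
open is closed; BSD is not proved by this. [cite: Kato2004Asterisque, (8.1.3) (p. 180), Thm. 9.7 (p. 189)]
[cite: KostersPannekoek2017, Thm. 1 and Cor. 2] [cite: CesnaviciusNeururerSaha2023, Thm. 1.2 and §1 p. 2]
[cite: EdixhovenManin1991, Thm. 3 and §4] [cite: WZhang2014, Thm. 1.1] -/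
theorem wAllExclAdditiveFiveLeRankOne_of_kato_cremona_of_kpResidue
    (hK : kato_neron_isIntegral_twistedSymbolSum_of_additive_five_le)
    (hCre : cremona_abs_maninConstant_eq_one_of_level_le_500000)
    (hKP : ∀ (p : ℕ) [Fact p.Prime] (V : WeierstrassCurve ℚ) [V.IsElliptic] [V.IsGloballyMinimal]
      [NeZero (V.conductorNorm ℤ)], (p = 5 ∨ p = 7) → Addv V p → Irr V p →
      (∀ (v : HeightOneSpectrum ℤ) (n : ℕ), natGenerator v = p →
        V.kodairaSymbolAt v ≠ KodairaSymbol.Istar n) →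
      padicValInt p V.minimalDiscriminantInt ≤ 4 →
      (∃ (W' : WeierstrassCurve ℚ) (_ : W'.IsElliptic) (_ : W'.IsGloballyMinimal)
        (P : (W'.baseChange ℚ_[p]).toAffine.Point), IsIsogenous V W' ∧ P ≠ 0 ∧ p • P = 0) →
      (∀ (W' : WeierstrassCurve ℚ) [W'.IsElliptic] [W'.IsGloballyMinimal]
        (D' : ModularParametrizationData W' (V.conductorNorm ℤ)),
        IsIsogenous V W' → p ∣ D'.modularDegree) →
      500000 < V.conductorNorm ℤ →
      ∃ D : ModularParametrizationData V (V.conductorNorm ℤ), ¬ (p : ℤ) ∣ D.c)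
    (h₁ : KolyvaginPrimitiveAdditive) (h₀ : RankZeroAdditive) (hoff : OffSharpRankOneAdditive)
    (hP : PublishedInputsAdditiveKoly) (hF : PublishedManinFacts) :
    Summit.BirchSwinnertonDyer.WAllExclAdditiveFiveLeRankOne :=
  wAllExclAdditiveFiveLeRankOne_of_kato hK
    (Summit.BirchSwinnertonDyer.BirchSwinnertonDyer.Theorems.TwistDegreeStepFiveSeven.twistDegreeStepFiveSeven_of_kato_cns_cremona_of_kpResidue
      hK hF.2.2.2.2.2.2 hCre hKP)
    h₁ h₀ hoff hP hF

end Summit.BirchSwinnertonDyer.BirchSwinnertonDyer.Theorems.EdixhovenFibreFiveSevenAssembly
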